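import Summits.ResolutionOfSingularities.ResolutionOfSingularities.Theorems.FrobeniusClosingPatchingRelPerfectRoofEngineClosedStep
import Summits.ResolutionOfSingularities.ResolutionOfSingularities.Theorems.FrobeniusClosingPatchingRelPerfectRoofEngineNonClosedStep
import Literature.AlgebraicGeometry.Resolution.ExcellentRingsFieldProofs
import HarnessLib

/-!
# Crux `PatchingRelPerfect` (stmt-ResolutionOfSingularities-16161), line `closed-point-slice`:
# stub `stub_roofEngine` — Temkin's Noetherian induction with regular roofs at closed points

Route `ResolutionOfSingularities/FrobeniusClosing`, crux #6 `PatchingRelPerfect`. This file proves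
the registered stub `stub_roofEngine` of the line `closed-point-slice` (skeleton v2.1), verbatim
(`LocalDesingNonClosedFour → PunctualPerfClosed p 4 → RoofEngine p`): for `k` perfect of
characteristic `p` and an integral separated `k`-scheme of finite type `M` of dimension `4` such
that every CLOSED point has a REGULAR ROOF (a proper birational `q : M → N` onto an integral
finite-type `k`-scheme of dimension `≤ 4` with `𝒪_{N,q m}` regular), `M` has a resolution of
singularities — given (`hE`) Temkin desingularizations of the local blow-ups at NON-closed points
of integral fourfolds over fields and (`hA`) fibre-supported regular blowing ups over regular local
bases essentially of finite type over perfect fields with finite residue field extension.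

## Proof (Temkin 2008, proof of Prop. 2.3.4, with two kinds of steps)

Well-founded induction on a closed subset `C ⊆ Sing M` (closed: `M` is of finite type over the
quasi-excellent `Spec k`) of the Noetherian space `M`, carrying a blowing up `f : X' → M` along an
ideal sheaf `J` with `η_M ∉ Supp J` such that `X'` is regular over `M ∖ C` (start: `C = Sing M`,
`f = 𝟙`, `J = ⊤`). Since `J ≠ 0`, `X'` is integral and `f` is proper and birational; if `X'` is
regular we are done. Otherwise `C ≠ ∅`.
* If `C` has a non-closed point, it has a non-closed MAXIMAL point `x`
  (`exists_maximal_point_not_isClosed`), `hE` desingularizes `X' ×_M Spec 𝒪_{M,x}`, and the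
  NON-CLOSED STEP `stub_roofEngineNonClosedStep` (Temkin's step verbatim) blows `X'` up.
* If every point of `C` is closed, pick `x ∈ C` and its roof `q : M → N`; the CLOSED STEP
  `stub_roofEngineClosedStep` runs Temkin's step over the base `N` at `n = q x` with `hA`.
Either step yields a blowing up `f' : X'' → X'` whose centre does not meet the generic fibre and
whose singular points lie over `C ∖ {x}`; `X'' → X' → M` is a blowing up (Stacks 080B,
`IsBlowup.exists_isBlowup_comp`) along an ideal sheaf with `η_M` off its support, the image `C'`
of `Sing X''` is closed (blowing ups are proper, `Sing X''` is closed) and `C' ⊆ C ∖ {x} < C`.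

## Sources

* M. Temkin, *Desingularization of quasi-excellent schemes in characteristic zero*, Adv. Math.
  219 (2008) 488–522 = arXiv:math/0703678: Lemma 2.1.1, Lemma 2.1.4, Prop. 2.3.4 and its proof
  (p. 12, arXiv pagination). [Temkin2008]
* O. Piltant, *An axiomatic version of Zariski's patching theorem*, RACSAM 107 (2013) 91–121,
  Prop. 5.1 (regular roofs from resolving systems — the origin of `hroof`). [Piltant2013]
* The Stacks Project, Tags 080A/080B (composition of blowing ups). [StacksProject]
-/

set_option linter.dupNamespace false -- single-problem summit: doubled namespace component is forced

noncomputable section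

open CategoryTheory CategoryTheory.Limits AlgebraicGeometry Literature.AlgebraicGeometry.Resolution
open TopologicalSpace IsLocalRing

namespace Summit.ResolutionOfSingularities.ResolutionOfSingularities.Theorems

/-- **STUB `stub_roofEngine` — the roof engine (= `LocalDesingNonClosedFour → PunctualPerfClosed p 4
→ RoofEngine p`, registered signature verbatim): Temkin's Noetherian induction on the closed bad
set `C ⊆ M`.** For `k` perfect of characteristic `p` and an integral separated `k`-scheme of
finite type `M` of dimension `4` with regular roofs at its closed points, `M` has a resolution of
singularities, given local desingularizations at non-closed points (`hE`) and the algebraized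
atom (`hA`). PROOF (Temkin 2008, proof of Prop. 2.3.4, `temkin2008_prop234_of_comp` adapted):
well-founded induction on a closed `C ⊆ Sing M` carrying a blowing up `f : X' → M` along `J`
with `η_M ∉ Supp J` and `X'` regular over `M ∖ C` (start: `C = Sing M`, closed since `M` is of
finite type over the quasi-excellent `Spec k`; `f = 𝟙`, `J = ⊤`). If `X'` is regular, `f` is a
resolution (`J ≠ 0` on the integral `M`: proper, birational). Otherwise `C ≠ ∅`; if `C` has a
non-closed point it has a non-closed MAXIMAL point `x` and the NON-CLOSED STEP
(`stub_roofEngineNonClosedStep`, fed by `hE`) applies; if every point of `C` is closed, pick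
`x ∈ C`, a regular roof `q : M → N` at `x` (`hroof`) and apply the CLOSED STEP
(`stub_roofEngineClosedStep`, fed by `hA`). Either step returns a blowing up `f' : X'' → X'`
whose centre misses the generic fibre and whose singular points lie over `C ∖ {x}`; the composite
`X'' → M` is a blowing up (Stacks 080B) along an ideal with `η_M` off its support, and the image
`C'` of `Sing X''` is closed (properness) with `C' ⊆ C ∖ {x} < C`.
[cite: Temkin2008, Prop. 2.3.4 (proof, p. 12) and Lemma 2.1.1] -/
theorem stub_roofEngine (p : ℕ) (hp : p.Prime)
    (hE : ∀ (k : Type) [Field k] (M : Scheme.{0}) (g : M ⟶ Spec (.of k)) [IsSeparated g]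
      [LocallyOfFiniteType g] [QuasiCompact g] [IsIntegral M], topologicalKrullDim M = 4 →
      ∀ ζ : M, ¬ IsClosed ({ζ} : Set M) →
      ∀ (X' : Scheme.{0}) (f : X' ⟶ M) (J : M.IdealSheafData), IsBlowup f J →
        Scheme.AdmitsDesingularization (pullback f (M.fromSpecStalk ζ)))
    (hA : ∀ (k : Type) [Field k] [CharP k p] [PerfectField k] (S : Type) [CommRing S]
      [IsRegularLocalRing S] [Algebra k S] [Algebra.EssFiniteType k S], ringKrullDim S ≤ (4 : ℕ) →
      Module.Finite k (S ⧸ IsLocalRing.maximalIdeal S) →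
      ∀ (T : Scheme.{0}) (f : T ⟶ Spec (.of S)), IsIntegral T → IsProper f → IsBirational f →
        (∀ t : T, f.base t ≠ IsLocalRing.closedPoint S → IsRegularLocalRing (T.presheaf.stalk t)) →
        ∃ (J : T.IdealSheafData) (T' : Scheme.{0}) (π : T' ⟶ T), J ≠ ⊥ ∧
          (∀ t : T, t ∈ J.support → f.base t = IsLocalRing.closedPoint S) ∧
          IsBlowup π J ∧ Scheme.IsRegular T')
    (k : Type) [Field k] [CharP k p] [PerfectField k] (M : Scheme.{0}) (g : M ⟶ Spec (.of k))
    [IsSeparated g] [LocallyOfFiniteType g] [QuasiCompact g] [IsIntegral M]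
    (hdim : topologicalKrullDim M = 4)
    (hroof : ∀ m : M, IsClosed ({m} : Set M) →
      ∃ (N : Scheme.{0}) (gN : N ⟶ Spec (.of k)) (q : M ⟶ N),
        IsSeparated gN ∧ LocallyOfFiniteType gN ∧ QuasiCompact gN ∧ IsIntegral N ∧
        q ≫ gN = g ∧ IsProper q ∧ IsBirational q ∧ topologicalKrullDim N ≤ 4 ∧
        IsRegularLocalRing (N.presheaf.stalk (q.base m))) :
    Scheme.HasResolution M := by
  have _ := hp -- the primality of `p` is not used by the engine
  -- `M` is Noetherian, its singular locus `T` is closed and misses the generic point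
  haveI : IsNoetherian M := Scheme.isNoetherian_of_finiteType_over_field g
  have hk : Scheme.IsQuasiExcellent (Spec (.of k)) :=
    Scheme.isQuasiExcellent_of_locallyOfFiniteType Stacks07QW_field_holds (𝟙 _)
  set T : Set M := (Scheme.regularLocus M)ᶜ with hT
  have hTc : IsClosed T := isClosed_compl_regularLocus_of_locallyOfFiniteType g hk
  have hηT : genericPoint M ∉ T := fun h => h (genericPoint_mem_regularLocus M)
  -- the induction statement
  suffices H : ∀ C : Closeds M, (C : Set M) ⊆ T →
      (∃ (X' : Scheme.{0}) (f : X' ⟶ M) (J : M.IdealSheafData), IsBlowup f J ∧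
        genericPoint M ∉ (J.support : Set M) ∧
        ∀ x' : X', f x' ∉ C → x' ∈ Scheme.regularLocus X') →
      Scheme.HasResolution M by
    refine H ⟨T, hTc⟩ subset_rfl ⟨M, 𝟙 M, ⊤, isBlowup_id_top M, ?_, fun x' hx' => ?_⟩
    · simp [Scheme.IdealSheafData.support_top]
    · simpa [hT] using hx'
  intro C
  induction C using WellFoundedLT.induction with
  | ind C ih =>
  intro hCT ⟨X', f, J, hf, hηJ, hreg⟩
  -- `J ≠ 0`, so `X'` is integral and `f` is proper birational
  have hne : J ≠ ⊥ := by
    rintro rfl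
    apply hηJ
    rw [Scheme.IdealSheafData.support_bot]
    trivial
  haveI : IsIntegral X' := hf.isIntegral hne
  haveI : IsProper f := hf.isProper
  haveI : IsNoetherian X' := Scheme.isNoetherian_of_finiteType_over_field (f ≫ g)
  -- either `X'` is already regular …
  by_cases hall : ∀ x' : X', x' ∈ Scheme.regularLocus X'
  · exact ⟨X', f, hf.isResolution' stacks02NS_holds hne fun x' =>
      (Scheme.mem_regularLocus x').mp (hall x')⟩
  -- … or `C` is nonempty
  push Not at hall
  obtain ⟨x₁, hx₁⟩ := hall
  have hx₁C : f x₁ ∈ (C : Set M) := by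
    by_contra h
    exact hx₁ (hreg x₁ h)
  have hηC : genericPoint M ∉ (C : Set M) := fun h => hηT (hCT h)
  -- THE STEP at a suitable point `x ∈ C`
  obtain ⟨x, hxC, X'', f', J', hf', hηJ', hstep⟩ : ∃ x ∈ (C : Set M),
      ∃ (X'' : Scheme.{0}) (f' : X'' ⟶ X') (J' : X'.IdealSheafData), IsBlowup f' J' ∧
        genericPoint M ∉ f '' (J'.support : Set X') ∧
        ∀ x'' : X'', x'' ∉ Scheme.regularLocus X'' →
          f (f' x'') ∈ (C : Set M) ∧ f (f' x'') ≠ x := by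
    by_cases hC : ∃ c ∈ (C : Set M), ¬ IsClosed ({c} : Set M)
    · -- NON-CLOSED STEP at a non-closed maximal point of `C`, fed by `hE`
      obtain ⟨c, hcC, hc⟩ := hC
      obtain ⟨x, hxC, hx, hmax⟩ := exists_maximal_point_not_isClosed C.isClosed hcC hc
      exact ⟨x, hxC, stub_roofEngineNonClosedStep g f C C.isClosed hηC hreg x hxC hmax
        (hE k M g hdim x hx X' f J hf)⟩
    · -- CLOSED STEP at the closed point `f x₁ ∈ C` under its regular roof, fed by `hA`
      push Not at hC
      obtain ⟨N, gN, q, -, hftN, hqcN, hintN, -, hqprop, hqbir, hdimN, hregN⟩ :=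
        hroof (f x₁) (hC _ hx₁C)
      haveI := hftN
      haveI := hqcN
      haveI := hintN
      haveI := hqprop
      exact ⟨f x₁, hx₁C, stub_roofEngineClosedStep p hA k gN hdimN q hqbir f
        (hf.isBirational' hne) C hC hηC hreg (f x₁) hx₁C hregN⟩
  -- the composite `X'' → X' → M` is a blowing up along an ideal sheaf not supported at `η_M`
  obtain ⟨Q, hQ, hQsupp⟩ := hf.exists_isBlowup_comp hf'
  have hηQ : genericPoint M ∉ (Q.support : Set M) := fun h => (hQsupp h).elim hηJ hηJ'
  -- `X''` is of finite type over `k`: its singular locus is closed, with closed image `C'`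
  haveI : IsProper f' := hf'.isProper
  have hreg'' : IsClosed (Scheme.regularLocus X'')ᶜ :=
    isClosed_compl_regularLocus_of_locallyOfFiniteType ((f' ≫ f) ≫ g) hk
  let C' : Closeds M :=
    ⟨(f' ≫ f) '' (Scheme.regularLocus X'')ᶜ, (f' ≫ f).isClosedMap _ hreg''⟩
  -- `C' ⊆ C ∖ {x}`
  have hC'C : (C' : Set M) ⊆ (C : Set M) \ {x} := by
    rintro _ ⟨x'', hx'', rfl⟩
    obtain ⟨h1, h2⟩ := hstep x'' hx''
    exact ⟨by rwa [Scheme.Hom.comp_apply], by rwa [Set.mem_singleton_iff, Scheme.Hom.comp_apply]⟩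
  have hlt : C' < C := by
    refine lt_of_le_of_ne (fun y hy => (hC'C hy).1) fun h => ?_
    have hx' : x ∈ (C' : Set M) := by
      rw [h]
      exact hxC
    exact (hC'C hx').2 rfl
  exact ih C' hlt (fun y hy => hCT (hC'C hy).1)
    ⟨X'', f' ≫ f, Q, hQ, hηQ, fun x'' hx'' => by
      by_contra h
      exact hx'' ⟨x'', h, rfl⟩⟩

end Summit.ResolutionOfSingularities.ResolutionOfSingularities.Theorems

end
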